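import Summits.ValiantsHypothesis.ValiantsHypothesis.Theorems.RigidityForcesSymmetryGrenetFirstOrderRankRigidConstGauge

/-!
# Route RigidityForcesSymmetry — `GrenetFirstOrderRankRigid` (item stmt-ValiantsHypothesis-21029),
line `grenet_gauge`: stub `stub_linearRigid`, step 6 — existence of genuine witnesses of a vertex pair

For the crux line `Cruxes/GrenetFirstOrderRankRigid/Lines/grenet_gauge.lean` (blueprint
`Lines/grenet_gauge-stub_linearRigid-PROOF.md`, §6; interface `…-BLOCKS.md`).  An entry `(i, j, v)`,
`v = (p, q)`, of a direction at Grenet's pencil is a TAIL entry if `R i` is a `v`-tail (`p ∉ R i`,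
`q = |R i|`; its pair is `(R i + p, C j)`) and a HEAD entry if `C j` is a `v`-head (`p ∈ C j`,
`|C j| = q + 1`; its pair is `(R i, C j - p)`); GENUINE = of one kind only.  This file constructs
genuine witnesses of a prescribed pair:

* `exists_genuine_head_of_pair` — every pair `(U, T)` of vertices with `U ≠ T`, `U ≠ univ`,
  `T ≠ univ` has a genuine head entry (row `U`, column `T + p'` with `p' ∈ U \\ T` if `|U| = |T|`,
  any `p' ∉ T` otherwise);
* `exists_genuine_tail_of_pair` — every pair `(S, R')` with `S ≠ R'`, `S ≠ ∅`, `R' ≠ ∅` has a genuine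
  tail entry (row `S - p₁`, column `R'`).

No new definitions.  VP ≠ VNP is not moved by this file.
-/

noncomputable section

open MvPolynomial Matrix Finset

namespace Summit.ValiantsHypothesis.Theorems.RigidityForcesSymmetry.GrenetGauge

open Literature.Computability.AlgebraicComplexity

variable {n N : ℕ} (e : Finset (Fin n) ≃ Fin (N + 1))

/-- **A genuine head witness of a pair.**  For vertices `U ≠ T`, both `≠ univ`, there are a row `i'`
with `R i' = U`, a column `j'` and a variable `v' = (p', |T|)` with `C j' = T + p'`, `p' ∉ T`, such that
`(i', j', v')` is a head entry (`p' ∈ C j'`, `|C j'| = |T| + 1`) and not a tail entry. [folklore] -/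
theorem exists_genuine_head_of_pair {U T : Finset (Fin n)} (hUT : U ≠ T) (hU : U ≠ univ)
    (hT : T ≠ univ) :
    ∃ (i' j' : Fin N) (v' : Fin n × Fin n),
      (v'.1 ∈ e.symm ((e ∅).succAbove j') ∧ (e.symm ((e ∅).succAbove j')).card = (v'.2 : ℕ) + 1) ∧
      ¬ (v'.1 ∉ e.symm ((e univ).succAbove i') ∧ (v'.2 : ℕ) = (e.symm ((e univ).succAbove i')).card) ∧
      e.symm ((e univ).succAbove i') = U ∧ (e.symm ((e ∅).succAbove j')).erase v'.1 = T := by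
  -- the letter `p'`
  obtain ⟨p', hp'T, hp'U⟩ : ∃ p', p' ∉ T ∧ (U.card = T.card → p' ∈ U) := by
    by_cases hc : U.card = T.card
    · have hne : (U \ T).Nonempty := by
        rw [Finset.sdiff_nonempty]
        intro hsub
        exact hUT (Finset.eq_of_subset_of_card_le hsub hc.ge)
      obtain ⟨p', hp'⟩ := hne
      exact ⟨p', (Finset.mem_sdiff.mp hp').2, fun _ => (Finset.mem_sdiff.mp hp').1⟩
    · obtain ⟨p', -, hp'⟩ := Finset.exists_mem_notMem_of_card_lt_card
        (show T.card < (univ : Finset (Fin n)).card from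
          lt_of_le_of_ne (Finset.card_le_univ T |>.trans_eq rfl) fun h => hT (Finset.eq_univ_of_card T (by
            rw [h, Finset.card_univ])))
      exact ⟨p', hp', fun h => absurd h hc⟩
  have hTlt : T.card < n := by
    have := Finset.card_lt_card (Finset.ssubset_univ_iff.mpr hT)
    rwa [Finset.card_univ, Fintype.card_fin] at this
  obtain ⟨i', hi'⟩ := exists_grenet_row_eq e hU
  obtain ⟨j', hj'⟩ := exists_grenet_col_eq e (Finset.insert_ne_empty p' T)
  refine ⟨i', j', (p', ⟨T.card, hTlt⟩), ⟨?_, ?_⟩, ?_, hi', ?_⟩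
  · rw [hj']; exact Finset.mem_insert_self _ _
  · rw [hj', Finset.card_insert_of_notMem hp'T]
  · rintro ⟨h1, h2⟩
    rw [hi'] at h1 h2
    simp only at h2
    exact h1 (hp'U h2.symm)
  · rw [hj', Finset.erase_insert hp'T]

/-- **A genuine tail witness of a pair.**  For vertices `S ≠ R'`, both `≠ ∅`, there are a row `i₁`
with `R i₁ = S - p₁` (`p₁ ∈ S`), the column `j₁` of `R'` and the variable `v₁ = (p₁, |S| - 1)` such
that `(i₁, j₁, v₁)` is a tail entry and not a head entry. [folklore] -/
theorem exists_genuine_tail_of_pair {S R' : Finset (Fin n)} (hSR : S ≠ R') (hS : S ≠ ∅)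
    (hR : R' ≠ ∅) :
    ∃ (i₁ j₁ : Fin N) (v₁ : Fin n × Fin n),
      (v₁.1 ∉ e.symm ((e univ).succAbove i₁) ∧ (v₁.2 : ℕ) = (e.symm ((e univ).succAbove i₁)).card) ∧
      ¬ (v₁.1 ∈ e.symm ((e ∅).succAbove j₁) ∧ (e.symm ((e ∅).succAbove j₁)).card = (v₁.2 : ℕ) + 1) ∧
      insert v₁.1 (e.symm ((e univ).succAbove i₁)) = S ∧ e.symm ((e ∅).succAbove j₁) = R' := by
  -- the letter `p₁ ∈ S`, outside `R'` when the sizes agree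
  obtain ⟨p₁, hp₁S, hp₁R⟩ : ∃ p₁, p₁ ∈ S ∧ (R'.card = S.card → p₁ ∉ R') := by
    by_cases hc : R'.card = S.card
    · have hne : (S \ R').Nonempty := by
        rw [Finset.sdiff_nonempty]
        intro hsub
        exact hSR (Finset.eq_of_subset_of_card_le hsub hc.le)
      obtain ⟨p₁, hp₁⟩ := hne
      exact ⟨p₁, (Finset.mem_sdiff.mp hp₁).1, fun _ => (Finset.mem_sdiff.mp hp₁).2⟩
    · obtain ⟨p₁, hp₁⟩ := Finset.nonempty_iff_ne_empty.mpr hS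
      exact ⟨p₁, hp₁, fun h => absurd h hc⟩
  have hSpos : 0 < S.card := Finset.card_pos.mpr (Finset.nonempty_iff_ne_empty.mpr hS)
  have hSle : S.card ≤ n := (Finset.card_le_univ S).trans_eq (Fintype.card_fin n)
  have hne : S.erase p₁ ≠ univ := fun h => by
    have := congrArg Finset.card h
    rw [Finset.card_erase_of_mem hp₁S, Finset.card_univ, Fintype.card_fin] at this; omega
  obtain ⟨i₁, hi₁⟩ := exists_grenet_row_eq e hne
  obtain ⟨j₁, hj₁⟩ := exists_grenet_col_eq e hR
  refine ⟨i₁, j₁, (p₁, ⟨S.card - 1, by omega⟩), ⟨?_, ?_⟩, ?_, ?_, hj₁⟩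
  · rw [hi₁]; exact Finset.notMem_erase p₁ S
  · rw [hi₁, Finset.card_erase_of_mem hp₁S]
  · rintro ⟨h1, h2⟩
    rw [hj₁] at h1 h2
    simp only at h2
    exact hp₁R (by omega) h1
  · rw [hi₁, Finset.insert_erase hp₁S]

end Summit.ValiantsHypothesis.Theorems.RigidityForcesSymmetry.GrenetGauge
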